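import Literature.AnabelianGeometry.EtaleTheta.FrobenioidThetaBaseSection
import Literature.AnabelianGeometry.EtaleTheta.Discharge.Sec4RootDivisors

/-!
# [EtTh] §5: the divisor-invariance clauses `hdivc` / `hdivp` FROM the Galois-stability of the divisor of `Θ̈` (Prop. 4.3 (i) proof, p.317; §5, p.330 / PDF pp.91, 104)

Mochizuki, *The étale theta function …*, Publ. RIMS **45** (2009)
[cite: MochizukiEtTh2009, Prop 4.3 (i) p.317 (PDF p.91); §5 p.330 (PDF p.104)].  Seat abc-iut-L2-t4 (§5 owner), ROW W3-L2-01
«§5 GENUINE DATA»; PROOF-ONLY companion of `FrobenioidThetaBaseSection.lean` (p418819) and `FrobenioidThetaOfBiKummerData.lean`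
(p417743).  Additive; no landed declaration is touched.

The assembled §5 data `ThetaFrobenioid.ofBiKummerData` take the divisor clauses `hdivc` (`Div(σ(g) ∘ s^⊓_N) = Div(s^⊓_N)`, all
`g ∈ Aut_D(A_N^bs)`) and `hdivp` (`Div(σ(ρ_{A_N}(y)) ∘ s^⊔_N) = Div(s^⊔_N)`, `y ∈ Π^tp_Ÿ`); `FrobenioidThetaBaseSection.lean` reduced
them to the bare invariances `Φ(g)(Div s^⊓_N) = Div s^⊓_N`, `Φ(ρ_{A_N}(y))(Div s^⊔_N) = Div s^⊔_N`.  This file PROVES those from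
ONE printed input each — the `Π^tp_X`-stability of the zero / polar divisor `Div(s')`, `Div(s'')` of the chosen right fraction-pair
`(s', s'')` of `Θ̈` on `A_⊙` (canonical: the positive / negative part of the principal divisor of `Θ̈`, Prop. 4.2 (i)) — along the
paper's own argument (Prop. 4.3 (i) proof, p.317 (PDF p.91): "`N · Div(s''_N)` … arise[s] as the pull-back via `A_N^bs → A_⊙^bs` of
`Div(s'')` … it suffices to observe that `Div(s')`, `Div(s'')` are fixed by `H`"; §5 p.330 (PDF p.104): "the zero divisor `Div(s^⊓_N)`
… descends to `A_⊚`"):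
* `NthRoot.pull_galoisSurj_eq_of_pow_eq` / `pull_galoisSurj_div_num` / `_den` — Galois-stability of `Div(s')` on `A^bs` PROPAGATES
  to `Div(s'_N)` on `A_N^bs` (`Div(s'_N)^N = (α^bs)^* Div(s')`: `NthRoot.div_num_pow` of `Discharge/Sec4RootDivisors.lean`), given the
  OUTER naturality of the Galois surjections along `α^bs` (Def. 4.1 (ii); binder `hS` in abc-iut-w5-d013's shape, a THEOREM at the
  temperoid) and "the fact that the monoid `Φ(A_N)` is torsion-free" (p.317; `pow_injective_of_isDivisorial`, `Φ` divisorial);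
  `pull_aut_div_num` — hence stability under ALL of `Aut_D(A_N^bs)` (the surjection is onto);
* `ThetaFrobenioid.hinvc_of_thetaDivisor` / `hinvp_of_thetaDivisor` — the two-step application `A_⊙ ← A_l ← A_N` of §5 (roots
  `Rl` of `Θ̈`, `R` of the `l`-th root): the `hinv` inputs of `hdivc_of_pull_invariant` / `hdivp_of_pull_invariant` from
  `hθ₊ : Φ(ρ_{A_⊙}(x))(Div s') = Div s'`, `hθ₋ : Φ(ρ_{A_⊙}(x))(Div s'') = Div s''` (`x ∈ Π^tp_X`); and the clauses themselves,
  `hdivc_of_thetaDivisor` / `hdivp_of_thetaDivisor`, for any section `σ`.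
HONEST FRAMING: kernel-checked implications over abc-iut-L2-t3's data structure; the stability of `Div(Θ̈)_±` under `Π^tp_X` is the
printed input (the divisor of `Θ̈` is supported on the special fibre / cusps and is `Gal(Ÿ/X) × G_K`-stable, Prop. 1.4); no side taken
on anything downstream.
-/

noncomputable section

namespace Literature.AnabelianGeometry.EtaleTheta

open CategoryTheory Opposite Literature.AlgebraicGeometry.Frobenioids

universe u₀ v₀ u v w

variable {K : Type u₀} [Field K]

/-! ## Divisors of the root pair: `Div(s'_N)^N = (α^bs)^* Div(s')` and its Galois-stability -/

namespace BiKummerSetting.NthRoot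

variable {X : SemiGraphs.TemperedArithmeticGroup.{u₀} K} {D₀ : Type u₀} [Category.{v₀} D₀]
  {V : FrdIMonoidStub.{w}} {T₀ : RealifiedDivisorMonoids (D₀ := D₀) V} {D : Type u} [Category.{v} D]
  {VD : FrdICatStub.{u, v, w} D} {S : BiKummerSetting X T₀ D VD}
  {pullFrac : ∀ {A A' : S.C} (_ : A' ⟶ A), S.biratUnits A → S.biratUnits A'}
  {A B : S.C} {f : S.biratUnits A} {P : S.FractionPair f B} {N : ℕ+} (R : S.NthRoot f P N pullFrac)

variable (hA : S.IsGaloisObj A.base) (hΦd : Objectwise (fun M _ => IsDivisorial M) S.tf.divisorMonoid)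
  (hS : ∀ ⦃A' B' : D⦄ (hA' : S.IsGaloisObj A') (hB' : S.IsGaloisObj B') (b : B' ⟶ A'),
    ∃ c : X.Pi, ∀ g : X.Pi, (S.galoisSurj B' hB' g).hom ≫ b = b ≫ (S.galoisSurj A' hA' (c * g * c⁻¹)).hom)

include hA hΦd hS in
/-- **Galois-stability propagates along roots**: if `x ↦ Φ(ρ_A(x))` fixes a divisor `d ∈ Φ(A^bs)` for all `x ∈ Π^tp_X`, then
`x ↦ Φ(ρ_{A_N}(x))` fixes every `e ∈ Φ(A_N^bs)` with `e^N = (α^bs)^* d` — by the OUTER naturality of `Π^tp_X ↠ Aut_D(−)` along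
`α^bs` (Def. 4.1 (ii)) and "the fact that the monoid `Φ(A_N)` is torsion-free" (p.317 (PDF p.91); `Φ` divisorial).
[cite: MochizukiEtTh2009, Def 4.1 (ii) p.313 (PDF p.87); Prop 4.3 (i) p.317 (PDF p.91)] -/
theorem pull_galoisSurj_eq_of_pow_eq {d : S.tf.divisorMonoid.obj (op A.base)} {e : S.tf.divisorMonoid.obj (op R.AN.base)}
    (he : e ^ (N : ℕ) = pull S.tf.divisorMonoid (ModelFrobenioid.baseMap R.α) d)
    (hinv : ∀ x : X.Pi, pull S.tf.divisorMonoid (S.galoisSurj A.base hA x).hom d = d) (x : X.Pi) :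
    pull S.tf.divisorMonoid (S.galoisSurj R.AN.base R.αData.isGalois x).hom e = e := by
  obtain ⟨c, hc⟩ := hS hA R.αData.isGalois (ModelFrobenioid.baseMap R.α)
  apply pow_injective_of_isDivisorial (hΦd R.AN.base) N
  rw [← map_pow, he, ← pull_comp, hc x, pull_comp, hinv]

include hA hΦd hS in
/-- **`Div(s'_N)` is `Π^tp_X`-stable if `Div(s')` is** (Prop. 4.3 (i) proof, p.317 (PDF p.91)).
[cite: MochizukiEtTh2009, Prop 4.3 (i) p.317 (PDF p.91)] -/
theorem pull_galoisSurj_div_num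
    (hinv : ∀ x : X.Pi, pull S.tf.divisorMonoid (S.galoisSurj A.base hA x).hom (ModelFrobenioid.div P.num) =
      ModelFrobenioid.div P.num) (x : X.Pi) :
    pull S.tf.divisorMonoid (S.galoisSurj R.AN.base R.αData.isGalois x).hom (ModelFrobenioid.div R.pair.num) =
      ModelFrobenioid.div R.pair.num :=
  pull_galoisSurj_eq_of_pow_eq R hA hΦd hS R.div_num_pow hinv x

include hA hΦd hS in
/-- **`Div(s''_N)` is `Π^tp_X`-stable if `Div(s'')` is** (Prop. 4.3 (i) proof, p.317 (PDF p.91)).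
[cite: MochizukiEtTh2009, Prop 4.3 (i) p.317 (PDF p.91)] -/
theorem pull_galoisSurj_div_den
    (hinv : ∀ x : X.Pi, pull S.tf.divisorMonoid (S.galoisSurj A.base hA x).hom (ModelFrobenioid.div P.den) =
      ModelFrobenioid.div P.den) (x : X.Pi) :
    pull S.tf.divisorMonoid (S.galoisSurj R.AN.base R.αData.isGalois x).hom (ModelFrobenioid.div R.pair.den) =
      ModelFrobenioid.div R.pair.den :=
  pull_galoisSurj_eq_of_pow_eq R hA hΦd hS R.div_den_pow hinv x

include hA hΦd hS in
/-- **`Div(s'_N)` is stable under ALL of `Aut_D(A_N^bs)` if `Div(s')` is `Π^tp_X`-stable** (`Π^tp_X ↠ Aut_D(A_N^bs)` is onto,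
Def. 4.1 (ii)) — §5 p.330 (PDF p.104): "the zero divisor `Div(s^⊓_N)` … descends".
[cite: MochizukiEtTh2009, Def 4.1 (ii) p.313 (PDF p.87); §5 p.330 (PDF p.104)] -/
theorem pull_aut_div_num
    (hinv : ∀ x : X.Pi, pull S.tf.divisorMonoid (S.galoisSurj A.base hA x).hom (ModelFrobenioid.div P.num) =
      ModelFrobenioid.div P.num) (g : Aut R.AN.base) :
    pull S.tf.divisorMonoid g.hom (ModelFrobenioid.div R.pair.num) = ModelFrobenioid.div R.pair.num := by
  obtain ⟨x, rfl⟩ := S.galoisSurj_surjective R.AN.base R.αData.isGalois g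
  exact pull_galoisSurj_div_num R hA hΦd hS hinv x

end BiKummerSetting.NthRoot

/-! ## The §5 two-step application `A_⊙ ← A_l ← A_N`: `hdivc`, `hdivp` from the stability of `Div(Θ̈)_±` -/

namespace ThetaFrobenioid

variable {X : SemiGraphs.TemperedArithmeticGroup.{u₀} K} {D₀ : Type u₀} [Category.{v₀} D₀]
  {V : FrdIMonoidStub.{w}} {T₀ : RealifiedDivisorMonoids (D₀ := D₀) V} {D : Type u} [Category.{v} D]
  {VD : FrdICatStub.{u, v, w} D} {S : BiKummerSetting X T₀ D VD}
  {pullFrac : ∀ {A A' : S.C} (_ : A' ⟶ A), S.biratUnits A → S.biratUnits A'}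
  {lv N : ℕ+} {T : ThetaEnvData.{max v w} N} {θ : S.biratUnits S.Aodot} {Bl : S.C}
  {Pl : S.FractionPair θ Bl} {Rl : S.NthRoot θ Pl lv pullFrac}
  (R : S.NthRoot Rl.root Rl.pair N pullFrac) (ιX : T.PiX ≃ₜ* X.Pi)
  (hΦd : Objectwise (fun M _ => IsDivisorial M) S.tf.divisorMonoid)
  (hS : ∀ ⦃A' B' : D⦄ (hA' : S.IsGaloisObj A') (hB' : S.IsGaloisObj B') (b : B' ⟶ A'),
    ∃ c : X.Pi, ∀ g : X.Pi, (S.galoisSurj B' hB' g).hom ≫ b = b ≫ (S.galoisSurj A' hA' (c * g * c⁻¹)).hom)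

include hΦd hS in
/-- **The `hinv` input of `hdivc_of_pull_invariant` from the `Π^tp_X`-stability of `Div(s')`, `(s', s'')` the fraction-pair of
`Θ̈` on `A_⊙`** (two steps `A_⊙ ← A_l ← A_N`; §5 p.330 (PDF p.104)): `Φ(g)(Div s^⊓_N) = Div s^⊓_N` for all `g ∈ Aut_D(A_N^bs)`.
[cite: MochizukiEtTh2009, §5 p.330 (PDF p.104); Prop 4.3 (i) p.317 (PDF p.91)] -/
theorem hinvc_of_thetaDivisor
    (hθ : ∀ x : X.Pi, pull S.tf.divisorMonoid (S.galoisSurj S.Aodot.base S.isGalois_Aodot x).hom (ModelFrobenioid.div Pl.num) =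
      ModelFrobenioid.div Pl.num) (g : Aut R.AN.base) :
    pull S.tf.divisorMonoid g.hom (ModelFrobenioid.div R.pair.num) = ModelFrobenioid.div R.pair.num :=
  BiKummerSetting.NthRoot.pull_aut_div_num R Rl.αData.isGalois hΦd hS
    (BiKummerSetting.NthRoot.pull_galoisSurj_div_num Rl S.isGalois_Aodot hΦd hS hθ) g

include hΦd hS in
/-- **The `hinv` input of `hdivp_of_pull_invariant` from the `Π^tp_X`-stability of `Div(s'')`** (Prop. 4.3 (i) proof, p.317 (PDF
p.91): "it suffices to observe that … `Div(s'')` [is] fixed"): `Φ(ρ_{A_N}(y))(Div s^⊔_N) = Div s^⊔_N` — for every `y ∈ Π^tp_X`, in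
particular on `Π^tp_Ÿ`.  [cite: MochizukiEtTh2009, Prop 4.3 (i) p.317 (PDF p.91)] -/
theorem hinvp_of_thetaDivisor
    (hθ' : ∀ x : X.Pi, pull S.tf.divisorMonoid (S.galoisSurj S.Aodot.base S.isGalois_Aodot x).hom (ModelFrobenioid.div Pl.den) =
      ModelFrobenioid.div Pl.den) (y : T.PiX) (_hy : y ∈ T.PiYdd) :
    pull S.tf.divisorMonoid (S.galoisSurj R.AN.base R.αData.isGalois (ιX y)).hom (ModelFrobenioid.div R.pair.den) =
      ModelFrobenioid.div R.pair.den :=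
  BiKummerSetting.NthRoot.pull_galoisSurj_div_den R Rl.αData.isGalois hΦd hS
    (BiKummerSetting.NthRoot.pull_galoisSurj_div_den Rl S.isGalois_Aodot hΦd hS hθ') (ιX y)

include hΦd hS in
/-- **The clause `hdivc` of `ofBiKummerData` from the stability of `Div(Θ̈)₊`**, for any section `σ` of `A_N`.
[cite: MochizukiEtTh2009, §5 p.330 (PDF p.104)] -/
theorem hdivc_of_thetaDivisor (σ : Aut R.AN.base →* Aut R.AN) (hσ : ∀ g : Aut R.AN.base, ModelFrobenioid.baseMap (σ g).hom = g.hom)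
    (hθ : ∀ x : X.Pi, pull S.tf.divisorMonoid (S.galoisSurj S.Aodot.base S.isGalois_Aodot x).hom (ModelFrobenioid.div Pl.num) =
      ModelFrobenioid.div Pl.num) (g : Aut R.BN.base) :
    ModelFrobenioid.div ((σ ((BiKummerSetting.NthRoot.baseIso S R).conjAut.symm g)).hom ≫ R.pair.num) =
      ModelFrobenioid.div R.pair.num :=
  hdivc_of_pull_invariant hΦd R σ hσ (hinvc_of_thetaDivisor R hΦd hS hθ) g

include hΦd hS in
/-- **The clause `hdivp` of `ofBiKummerData` from the stability of `Div(Θ̈)₋`**, for any section `σ` of `A_N`.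
[cite: MochizukiEtTh2009, Prop 4.3 (i) p.317 (PDF p.91); §5 p.331 (PDF p.105)] -/
theorem hdivp_of_thetaDivisor (σ : Aut R.AN.base →* Aut R.AN) (hσ : ∀ g : Aut R.AN.base, ModelFrobenioid.baseMap (σ g).hom = g.hom)
    (hθ' : ∀ x : X.Pi, pull S.tf.divisorMonoid (S.galoisSurj S.Aodot.base S.isGalois_Aodot x).hom (ModelFrobenioid.div Pl.den) =
      ModelFrobenioid.div Pl.den) (y : T.PiYdd) :
    ModelFrobenioid.div ((σ (S.galoisSurj R.AN.base R.αData.isGalois (ιX y.1))).hom ≫ R.pair.den) =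
      ModelFrobenioid.div R.pair.den :=
  hdivp_of_pull_invariant hΦd R ιX σ hσ (hinvp_of_thetaDivisor R ιX hΦd hS hθ') y

end ThetaFrobenioid

end Literature.AnabelianGeometry.EtaleTheta

end
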